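import Summits.BirchSwinnertonDyer.Rank1Residual.P2.CongruentNumberThetaThreePrimesE
import HarnessLib
import HarnessLib.Audit.Tags

/-!
# Cell «bsd-monsky» (prover-B): a `k = 4` type THROUGH THE UNIFORM Θ-CRITERION — `n = 2p₁p₂p₃p₄`, `p₁ ≡ 3`,
# `p₂ ≡ p₃ ≡ p₄ ≡ 5 (mod 8)`: `θ`-controlled (composite good `5`-block `p₂p₃p₄`), Θ-certificate
# `Θ(n) = g(n) + Σᵢ 𝓛(pⱼp_k)·g(2p₁pᵢ) ≡ g(n)`, and `g(n) ≡ 1 + Σ_{pairs of symbols sharing a prime} sₐs_b` (`decide`, `t = 4`)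
# — part 1: arithmetic, configuration, certificate (kernel lemmas; nothing asserted, nothing booked)

HONEST FRAMING (cell `bsd-monsky`, run/shared/lean/pub/bsd-monsky/; README §1/§3): the cell's CLAIMED theorem is Monsky's 1990
conjecture on the `k = 2` family `𝒮⁻`; «ℓ ≥ 3 rungs are NOT claimed — record what the same argument gives there, no more». THIS FILE
(with `…ThetaFourPrimesFamily.lean`) is the FIRST `k = 4` instance of the record: the scope census (HOME/proof/PROOF-B-K3-SCOPE.md §4,
kit j246343) lists `[3,5,5,5]` among the fifteen `k = 4` types on which `θ` decides silent cells (smallest `11310 = 2·3·5·13·29`); the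
UNIFORM Θ-criterion `ThetaDescent.odd_scriptL_of_thetaCert` (`P2/CongruentNumberThetaCriterion.lean`) is `k`-free, and the per-type
work is again residue arithmetic + one `decide` (the `5 × 5` Rédei matrix of `ℚ(√−2p₁p₂p₃p₄)` on `64` symbol patterns). Nothing is
asserted: CONDITIONAL on TYZ data with the displayed sentences (`tyz_cmPointGaloisData`), on TYZ Thm. 1.1 (`thm11_parity_of_scriptL`,
for `𝓛(pⱼp_k) mod 2`) and on a rank input where said; Rédei–Reichardt is the tree's theorem. No `BSD(E, 2)` statement is made at
`k = 4` (the tree's even `2`-descent door is for three odd primes): the output is `𝓛(n)` odd / `ord_{s=1} L(E_n, s) = 1`. No count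
moves, no class is booked; NOT refereed; not part of PROOF-B v1.3 or of the paper.

THE TYPE. `p₁ ≡ 3`, `p₂, p₃, p₄ ≡ 5 (mod 8)` distinct, `P = p₂p₃p₄ ≡ 5`, `m = p₁P ≡ 7`, `n = 2m ≡ 6 (mod 8)`. The `6`-blocks are the
`2p₁z`, `z ∣ P` (`2p₁ ≡ 6`, `2p₁pᵢ`, `2p₁pᵢpⱼ`, `n`); cofactor `P/z ≡ 1 (mod 8)` iff `z = pᵢ` (cofactor `pⱼp_k`) or `z = P`. The
`5`-divisors of `n` are `pᵢ` and `P` (all primes `≡ 1 (mod 4)`: GOOD) — so `n` is `θ`-controlled. `R(2p₁pᵢ)` has no `6`-block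
(`filter_six_recursionIndex_two_mul_35`), the `6`-blocks of `R(n)` are the `2p₁pᵢ` with cofactors `pⱼp_k`, and `𝓛(pⱼp_k)` is EVEN
(`g(pⱼp_k)` even for `pⱼ ≡ p_k ≡ 5 (mod 8)` — §2b below, a two-prime Rédei bit — and TYZ Thm. 1.1): **`Θ(n) ≡ g(n)`**. Configuration: with
`s₀ = [(p₂/p₁) = −1]`, `s₁ = [(p₃/p₁) = −1]`, `s₂ = [(p₄/p₁) = −1]`, `s₃ = [(p₃/p₂) = −1]`, `s₄ = [(p₄/p₂) = −1]`, `s₅ = [(p₄/p₃) = −1]`: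
`g(n) ≡ 1 + Σ_{a<b} sₐs_b + s₀s₅ + s₁s₄ + s₂s₃` (i.e. `1 +` the number of pairs of `−1`-symbols sharing a prime).

References: [TianYuanZhang2017] Thm. 1.1, §3.1 (p0011 L67–L73), Prop. 3.2, Thm. 3.5, Thm. 3.6 (J741), proof of Lemma 3.21 (J759);
[LiMa2008] Thm. 0.4, Lemma 0.1; [IrelandRosen1990] Ch. 5 §2 Thm. 1; HOME/proof/PROOF-B-THETA-CRITERION.md.
-/

noncomputable section

open scoped Classical

open Matrix Finset WeierstrassCurve Literature.NumberTheory.EllipticCurves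
  Literature.NumberTheory.EllipticCurves.Rank1Residual
  Literature.NumberTheory.EllipticCurves.Rank1Residual.Typed
  Literature.NumberTheory.EllipticCurves.HeathBrown1994
  Literature.NumberTheory.EllipticCurves.Tian2014
  Literature.NumberTheory.EllipticCurves.TianYuanZhang2017
  Literature.NumberTheory.EllipticCurves.TianYuanZhang2017.W2
  Literature.NumberTheory.QuadraticFields.RedeiReichardt

set_option autoImplicit false

namespace Summit.BirchSwinnertonDyer.Rank1Residual.P2

namespace ThetaDescent

variable {p₁ p₂ p₃ p₄ : ℕ}

/-! ## §1 Arithmetic of the type `(3, 5, 5, 5)` -/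

/-- Divisors of `P = p₂p₃p₄` (`pᵢ ≡ 5 (mod 8)`): `z ≡ 1, 5 (mod 8)`, and `P/z ≡ 1 (mod 8)` with `z < P` forces `z = pᵢ`.
[cite: HardyWright2008, §1.3 Thm. 2] -/
theorem dvd_P_3555 (hp₂ : p₂.Prime) (hp₃ : p₃.Prime) (hp₄ : p₄.Prime) (h₂ : p₂ % 8 = 5) (h₃ : p₃ % 8 = 5)
    (h₄ : p₄ % 8 = 5) {z : ℕ} (hz : z ∣ p₂ * p₃ * p₄) :
    (z % 8 = 1 ∨ z % 8 = 5) ∧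
      ((p₂ * p₃ * p₄ / z) % 8 = 1 → z = p₂ * p₃ * p₄ ∨ z = p₂ ∨ z = p₃ ∨ z = p₄) := by
  have h23 : (p₂ * p₃) % 8 = 1 := by rw [Nat.mul_mod, h₂, h₃]
  have h24 : (p₂ * p₄) % 8 = 1 := by rw [Nat.mul_mod, h₂, h₄]
  have h34 : (p₃ * p₄) % 8 = 1 := by rw [Nat.mul_mod, h₃, h₄]
  have hP : (p₂ * p₃ * p₄) % 8 = 5 := by rw [Nat.mul_mod, h23, h₄]
  have hP0 : p₂ * p₃ * p₄ ≠ 0 := Nat.mul_ne_zero (Nat.mul_ne_zero hp₂.ne_zero hp₃.ne_zero) hp₄.ne_zero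
  have e1 : p₂ * p₃ * p₄ / 1 = p₂ * p₃ * p₄ := Nat.div_one _
  have e₂ : p₂ * p₃ * p₄ / p₂ = p₃ * p₄ := by
    rw [show p₂ * p₃ * p₄ = p₂ * (p₃ * p₄) by ring]; exact Nat.mul_div_cancel_left _ hp₂.pos
  have e₃ : p₂ * p₃ * p₄ / p₃ = p₂ * p₄ := by
    rw [show p₂ * p₃ * p₄ = p₃ * (p₂ * p₄) by ring]; exact Nat.mul_div_cancel_left _ hp₃.pos
  have e₄ : p₂ * p₃ * p₄ / p₄ = p₂ * p₃ := Nat.mul_div_cancel _ hp₄.pos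
  have e₂₃ : p₂ * p₃ * p₄ / (p₂ * p₃) = p₄ := Nat.mul_div_cancel_left _ (Nat.mul_pos hp₂.pos hp₃.pos)
  have e₂₄ : p₂ * p₃ * p₄ / (p₂ * p₄) = p₃ := by
    rw [show p₂ * p₃ * p₄ = (p₂ * p₄) * p₃ by ring]; exact Nat.mul_div_cancel_left _ (Nat.mul_pos hp₂.pos hp₄.pos)
  have e₃₄ : p₂ * p₃ * p₄ / (p₃ * p₄) = p₂ := by
    rw [show p₂ * p₃ * p₄ = (p₃ * p₄) * p₂ by ring]; exact Nat.mul_div_cancel_left _ (Nat.mul_pos hp₃.pos hp₄.pos)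
  have eP : p₂ * p₃ * p₄ / (p₂ * p₃ * p₄) = 1 := Nat.div_self (Nat.pos_of_ne_zero hP0)
  rcases (dvd_mul_three_iff hp₂ hp₃ hp₄).mp hz with rfl | rfl | rfl | rfl | rfl | rfl | rfl | rfl
  · exact ⟨by omega, fun h => by rw [e1] at h; omega⟩
  · exact ⟨by omega, fun _ => Or.inr (Or.inl rfl)⟩
  · exact ⟨by omega, fun _ => Or.inr (Or.inr (Or.inl rfl))⟩
  · exact ⟨by omega, fun _ => Or.inr (Or.inr (Or.inr rfl))⟩
  · exact ⟨by omega, fun h => by rw [e₂₃] at h; omega⟩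
  · exact ⟨by omega, fun h => by rw [e₂₄] at h; omega⟩
  · exact ⟨by omega, fun h => by rw [e₃₄] at h; omega⟩
  · exact ⟨by omega, fun _ => Or.inl rfl⟩

/-- **The `6`-blocks of `n = 2p₁p₂p₃p₄` (type `(3,5,5,5)`) are the `2p₁z`, `z ∣ p₂p₃p₄`.** [cite: TianYuanZhang2017, §3.1 (p0011 L67–L70)] -/
theorem six_block_3555 (hp₁ : p₁.Prime) (hp₂ : p₂.Prime) (hp₃ : p₃.Prime) (hp₄ : p₄.Prime) (h₁ : p₁ % 8 = 3)
    (h₂ : p₂ % 8 = 5) (h₃ : p₃ % 8 = 5) (h₄ : p₄ % 8 = 5) {e : ℕ} (he : e ∣ 2 * (p₁ * p₂ * p₃ * p₄)) (he6 : e % 8 = 6) :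
    ∃ z : ℕ, z ∣ p₂ * p₃ * p₄ ∧ e = 2 * p₁ * z := by
  have he' : e ∣ 2 * (p₁ * (p₂ * p₃ * p₄)) := by rwa [show p₁ * p₂ * p₃ * p₄ = p₁ * (p₂ * p₃ * p₄) by ring] at he
  obtain ⟨y, w, hy, hw, rfl⟩ := Nat.dvd_mul.mp he'
  obtain ⟨y', z, hy', hz, rfl⟩ := Nat.dvd_mul.mp hw
  obtain ⟨hz15, -⟩ := dvd_P_3555 hp₂ hp₃ hp₄ h₂ h₃ h₄ hz
  rcases (Nat.dvd_prime Nat.prime_two).mp hy with hy2 | hy2 <;>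
    rcases (Nat.dvd_prime hp₁).mp hy' with hy1 | hy1
  · exfalso; rw [hy2, hy1] at he6; omega
  · exfalso
    rw [hy2, hy1] at he6
    have : (1 * (p₁ * z)) % 8 = 3 ∨ (1 * (p₁ * z)) % 8 = 7 := by
      rw [one_mul, Nat.mul_mod, h₁]; rcases hz15 with h | h <;> rw [h] <;> decide
    omega
  · exfalso; rw [hy2, hy1] at he6; omega
  · exact ⟨z, hz, by rw [hy2, hy1]; ring⟩

/-- **Every `5`-divisor of `n = 2p₁p₂p₃p₄` (type `(3,5,5,5)`) is GOOD** (its primes are among `p₂, p₃, p₄ ≡ 1 (mod 4)`): `n` is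
`θ`-controlled, the composite `5`-block `p₂p₃p₄` included. [cite: TianYuanZhang2017, §3.1 (p0011 L67–L70)] -/
theorem fiveGood_of_dvd_two_mul_3555 (hp₁ : p₁.Prime) (hp₂ : p₂.Prime) (hp₃ : p₃.Prime) (hp₄ : p₄.Prime) (h₁ : p₁ % 8 = 3)
    (h₂ : p₂ % 8 = 5) (h₃ : p₃ % 8 = 5) (h₄ : p₄ % 8 = 5) {d' : ℕ} (hd' : d' ∣ 2 * (p₁ * p₂ * p₃ * p₄)) (h5 : d' % 8 = 5) :
    ∀ r ∈ d'.primeFactors, r % 4 = 1 := by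
  intro r hr
  obtain ⟨hrp, hrd, -⟩ := Nat.mem_primeFactors.mp hr
  have hrn : r ∣ 2 * (p₁ * (p₂ * p₃ * p₄)) := by
    rw [show p₁ * (p₂ * p₃ * p₄) = p₁ * p₂ * p₃ * p₄ by ring]; exact hrd.trans hd'
  rcases (Nat.Prime.dvd_mul hrp).mp hrn with h2 | hrest
  · -- `r = 2` divides the odd `d'`
    have := (Nat.prime_dvd_prime_iff_eq hrp Nat.prime_two).mp h2
    subst this; omega
  rcases (Nat.Prime.dvd_mul hrp).mp hrest with hrp₁ | hrP
  · -- `r = p₁`: then `d' = p₁·e` with `e ∣ p₂p₃p₄` odd, so `d' ≡ 3, 7 (mod 8)`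
    have hr1 : r = p₁ := (Nat.prime_dvd_prime_iff_eq hrp hp₁).mp hrp₁
    rw [hr1] at hrd
    obtain ⟨e, he⟩ := hrd
    have he2P : e ∣ 2 * (p₂ * p₃ * p₄) := by
      have h' : p₁ * e ∣ p₁ * (2 * (p₂ * p₃ * p₄)) := by
        rw [← he, show p₁ * (2 * (p₂ * p₃ * p₄)) = 2 * (p₁ * p₂ * p₃ * p₄) by ring]; exact hd'
      exact Nat.dvd_of_mul_dvd_mul_left hp₁.pos h'
    have hd'odd : Odd d' := Nat.odd_iff.mpr (by omega)
    have heodd : Odd e := by rw [he] at hd'odd; exact (Nat.odd_mul.mp hd'odd).2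
    have heP : e ∣ p₂ * p₃ * p₄ := (Nat.coprime_two_right.mpr heodd).dvd_of_dvd_mul_left he2P
    obtain ⟨he15, -⟩ := dvd_P_3555 hp₂ hp₃ hp₄ h₂ h₃ h₄ heP
    have : d' % 8 = 3 ∨ d' % 8 = 7 := by
      rw [he, Nat.mul_mod, h₁]; rcases he15 with h | h <;> rw [h] <;> decide
    omega
  · rcases (Nat.Prime.dvd_mul hrp).mp hrP with h23' | h4'
    · rcases (Nat.Prime.dvd_mul hrp).mp h23' with h2' | h3'
      · rw [(Nat.prime_dvd_prime_iff_eq hrp hp₂).mp h2']; omega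
      · rw [(Nat.prime_dvd_prime_iff_eq hrp hp₃).mp h3']; omega
    · rw [(Nat.prime_dvd_prime_iff_eq hrp hp₄).mp h4']; omega

/-- **`2p₁p₂p₃p₄` (type `(3,5,5,5)`) is `θ`-controlled.** [cite: TianYuanZhang2017, §3.1 (p0011 L67–L70)] -/
theorem thetaControlled_two_mul_3555 (hp₁ : p₁.Prime) (hp₂ : p₂.Prime) (hp₃ : p₃.Prime) (hp₄ : p₄.Prime) (h₁ : p₁ % 8 = 3)
    (h₂ : p₂ % 8 = 5) (h₃ : p₃ % 8 = 5) (h₄ : p₄ % 8 = 5) :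
    ∀ d₀ ∈ (2 * (p₁ * p₂ * p₃ * p₄)).divisors, d₀ % 8 = 7 → (2 * (p₁ * p₂ * p₃ * p₄) / d₀) % 8 = 2 →
      ∀ d' ∈ d₀.divisors, d' % 8 = 5 → ∀ r ∈ d'.primeFactors, r % 4 = 1 := fun _ hd₀ _ _ _ hd' h5 =>
  fiveGood_of_dvd_two_mul_3555 hp₁ hp₂ hp₃ hp₄ h₁ h₂ h₃ h₄
    ((Nat.mem_divisors.mp hd').1.trans (Nat.mem_divisors.mp hd₀).1) h5

/-! ## §2 The configuration (`t = 4`): `g(n) mod 2` on the `64` symbol patterns -/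

/-- The prime quadruple of the type `(3,5,5,5)`: primes, none `2`, injective. [cite: HardyWright2008, §1.3 Thm. 2] -/
theorem quad_3555 (hp₁ : p₁.Prime) (hp₂ : p₂.Prime) (hp₃ : p₃.Prime) (hp₄ : p₄.Prime) (h₁ : p₁ % 8 = 3) (h₂ : p₂ % 8 = 5)
    (h₃ : p₃ % 8 = 5) (h₄ : p₄ % 8 = 5) (h23 : p₂ ≠ p₃) (h24 : p₂ ≠ p₄) (h34 : p₃ ≠ p₄) :
    (∀ i, ((![p₁, p₂, p₃, p₄] : Fin 4 → ℕ) i).Prime) ∧ (∀ i, (![p₁, p₂, p₃, p₄] : Fin 4 → ℕ) i ≠ 2) ∧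
      Function.Injective (![p₁, p₂, p₃, p₄] : Fin 4 → ℕ) := by
  have h12 : p₁ ≠ p₂ := fun h => by omega
  have h13 : p₁ ≠ p₃ := fun h => by omega
  have h14 : p₁ ≠ p₄ := fun h => by omega
  refine ⟨fun i => by fin_cases i <;> assumption, fun i => by fin_cases i <;> simp <;> omega, ?_⟩
  intro i j h
  fin_cases i <;> fin_cases j <;> simp_all

/-- **The Legendre configuration of the type `(3,5,5,5)`**: residues `(3,5,5,5)` and the SYMMETRIC bit matrix on the six bits
`s₀ = [(p₂/p₁) = −1]`, `s₁ = [(p₃/p₁) = −1]`, `s₂ = [(p₄/p₁) = −1]`, `s₃ = [(p₃/p₂) = −1]`, `s₄ = [(p₄/p₂) = −1]`, `s₅ = [(p₄/p₃) = −1]`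
(reciprocity: only `p₁` is `≡ 3 (mod 4)`). [cite: IrelandRosen1990, Ch. 5 §2 Thm. 1 (quadratic reciprocity)] -/
theorem cfg_3555 (hp₁ : p₁.Prime) (hp₂ : p₂.Prime) (hp₃ : p₃.Prime) (hp₄ : p₄.Prime) (h₁ : p₁ % 8 = 3) (h₂ : p₂ % 8 = 5)
    (h₃ : p₃ % 8 = 5) (h₄ : p₄ % 8 = 5) (h23 : p₂ ≠ p₃) (h24 : p₂ ≠ p₄) (h34 : p₃ ≠ p₄) :
    (fun i => (![p₁, p₂, p₃, p₄] : Fin 4 → ℕ) i % 8) = ![3, 5, 5, 5] ∧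
    (fun a b => kroneckerBit ((![p₁, p₂, p₃, p₄] : Fin 4 → ℕ) b) ((![p₁, p₂, p₃, p₄] : Fin 4 → ℕ) a)) =
      ![![0, kroneckerBit p₂ p₁, kroneckerBit p₃ p₁, kroneckerBit p₄ p₁],
        ![kroneckerBit p₂ p₁, 0, kroneckerBit p₃ p₂, kroneckerBit p₄ p₂],
        ![kroneckerBit p₃ p₁, kroneckerBit p₃ p₂, 0, kroneckerBit p₄ p₃],
        ![kroneckerBit p₄ p₁, kroneckerBit p₄ p₂, kroneckerBit p₄ p₃, 0]] := by
  have hp₁2 : p₁ ≠ 2 := by omega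
  have hp₂2 : p₂ ≠ 2 := by omega
  have hp₃2 : p₃ ≠ 2 := by omega
  have hp₄2 : p₄ ≠ 2 := by omega
  have h12 : p₁ ≠ p₂ := fun h => by omega
  have h13 : p₁ ≠ p₃ := fun h => by omega
  have h14 : p₁ ≠ p₄ := fun h => by omega
  have c1 : p₁ % 4 = 3 := by omega
  have c2 : p₂ % 4 = 1 := by omega
  have c3 : p₃ % 4 = 1 := by omega
  have c4 : p₄ % 4 = 1 := by omega
  refine ⟨?_, ?_⟩
  · funext i; fin_cases i <;> simp [h₁, h₂, h₃, h₄]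
  · funext a b
    fin_cases a <;> fin_cases b
    · simpa using kroneckerBit_self hp₁
    · simp
    · simp
    · simp
    · simp [kroneckerBit_swap hp₁ hp₂ hp₁2 hp₂2 h12, chi4Bit, c1, c2]
    · simpa using kroneckerBit_self hp₂
    · simp
    · simp
    · simp [kroneckerBit_swap hp₁ hp₃ hp₁2 hp₃2 h13, chi4Bit, c1, c3]
    · simp [kroneckerBit_swap hp₂ hp₃ hp₂2 hp₃2 h23, chi4Bit, c2, c3]
    · simpa using kroneckerBit_self hp₃
    · simp
    · simp [kroneckerBit_swap hp₁ hp₄ hp₁2 hp₄2 h14, chi4Bit, c1, c4]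
    · simp [kroneckerBit_swap hp₂ hp₄ hp₂2 hp₄2 h24, chi4Bit, c2, c4]
    · simp [kroneckerBit_swap hp₃ hp₄ hp₃2 hp₄2 h34, chi4Bit, c3, c4]
    · simpa using kroneckerBit_self hp₄

/-- **The Rédei bit of `ℚ(√−2p₁p₂p₃p₄)` on the type `(3,5,5,5)`** (`t = 4`, `64` patterns): `g(n) ≡ 1 + Σ_{a<b} sₐs_b + s₀s₅ + s₁s₄ +
s₂s₃` — one plus the number of pairs of `−1`-symbols that share a prime. [cite: LiMa2008, Thm. 0.4 with Lemma 0.1, Def. 0.2 (p. 279)] -/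
theorem gBitCfgTwo_3555 : ∀ s₀ s₁ s₂ s₃ s₄ s₅ : ZMod 2,
    gBitCfgTwo ![3, 5, 5, 5] (![![0, s₀, s₁, s₂], ![s₀, 0, s₃, s₄], ![s₁, s₃, 0, s₅], ![s₂, s₄, s₅, 0]] : Fin 4 → Fin 4 → ZMod 2) =
      1 + (s₀ * s₁ + s₀ * s₂ + s₀ * s₃ + s₀ * s₄ + s₁ * s₂ + s₁ * s₃ + s₁ * s₅ + s₂ * s₄ + s₂ * s₅ + s₃ * s₄ + s₃ * s₅ +
        s₄ * s₅) := by
  decide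

/-- **`g(2p₁p₂p₃p₄)` mod `2` on the type `(3,5,5,5)`** in terms of the six symbols (RR instantiated).
[cite: LiMa2008, Thm. 0.4] [cite: TianYuanZhang2017, §1 (p0002 L78–L82: g(d))] -/
theorem natCast_gK_two_mul_3555 (hp₁ : p₁.Prime) (hp₂ : p₂.Prime) (hp₃ : p₃.Prime) (hp₄ : p₄.Prime) (h₁ : p₁ % 8 = 3)
    (h₂ : p₂ % 8 = 5) (h₃ : p₃ % 8 = 5) (h₄ : p₄ % 8 = 5) (h23 : p₂ ≠ p₃) (h24 : p₂ ≠ p₄) (h34 : p₃ ≠ p₄) :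
    ((gK (2 * (p₁ * p₂ * p₃ * p₄)) : ℕ) : ZMod 2) =
      1 + (kroneckerBit p₂ p₁ * kroneckerBit p₃ p₁ + kroneckerBit p₂ p₁ * kroneckerBit p₄ p₁ +
        kroneckerBit p₂ p₁ * kroneckerBit p₃ p₂ + kroneckerBit p₂ p₁ * kroneckerBit p₄ p₂ +
        kroneckerBit p₃ p₁ * kroneckerBit p₄ p₁ + kroneckerBit p₃ p₁ * kroneckerBit p₃ p₂ + kroneckerBit p₃ p₁ * kroneckerBit p₄ p₃ +
        kroneckerBit p₄ p₁ * kroneckerBit p₄ p₂ + kroneckerBit p₄ p₁ * kroneckerBit p₄ p₃ +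
        kroneckerBit p₃ p₂ * kroneckerBit p₄ p₂ + kroneckerBit p₃ p₂ * kroneckerBit p₄ p₃ + kroneckerBit p₄ p₂ * kroneckerBit p₄ p₃) := by
  obtain ⟨ht, ht2, hinj⟩ := quad_3555 hp₁ hp₂ hp₃ hp₄ h₁ h₂ h₃ h₄ h23 h24 h34
  obtain ⟨hR, hB⟩ := cfg_3555 hp₁ hp₂ hp₃ hp₄ h₁ h₂ h₃ h₄ h23 h24 h34
  have hprod : 2 * ∏ i, (![p₁, p₂, p₃, p₄] : Fin 4 → ℕ) i = 2 * (p₁ * p₂ * p₃ * p₄) := by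
    rw [Fin.prod_univ_four]; rfl
  have h := natCast_genusClassNumber_two_mul_eq_gBitCfgTwo redeiReichardt_fourTwoCard_classGroup_holds _ ht ht2 hinj
  rw [hprod, hR, hB, gBitCfgTwo_3555] at h
  unfold gK
  exact h


/-! ## §2b `g(qr)` and `𝓛(qr)` are even for primes `q ≡ r ≡ 5 (mod 8)` (two-prime configuration; no third prime needed) -/

/-- The Rédei bit of `ℚ(√−qr)`, `q ≡ r ≡ 5 (mod 8)` (discriminant `−4qr`, `t = 3`): `g(qr)` is EVEN for both values of `[(r/q) = −1]`.
[cite: LiMa2008, Thm. 0.4 with Lemma 0.1, Def. 0.2 (p. 279)] -/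
theorem gBitCfg_55 : ∀ s : ZMod 2, gBitCfg ![5, 5] (![![0, s], ![s, 0]] : Fin 2 → Fin 2 → ZMod 2) = 0 := by
  decide

/-- **`g(qr)` is EVEN for distinct primes `q ≡ r ≡ 5 (mod 8)`** (RR instantiated on the two-prime configuration).
[cite: LiMa2008, Thm. 0.4] [cite: TianYuanZhang2017, §1 (p0002 L78–L82: g(d))] -/
theorem not_odd_gK_mul_55 {q r : ℕ} (hq : q.Prime) (hr : r.Prime) (hq5 : q % 8 = 5) (hr5 : r % 8 = 5) (hqr : q ≠ r) :
    ¬ Odd (gK (q * r)) := by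
  have hq2 : q ≠ 2 := by omega
  have hr2 : r ≠ 2 := by omega
  have ht : ∀ i, ((![q, r] : Fin 2 → ℕ) i).Prime := fun i => by fin_cases i <;> assumption
  have ht2 : ∀ i, (![q, r] : Fin 2 → ℕ) i ≠ 2 := fun i => by fin_cases i <;> assumption
  have hinj : Function.Injective (![q, r] : Fin 2 → ℕ) := by
    intro i j h; fin_cases i <;> fin_cases j <;> simp_all [hqr.symm]
  have h := natCast_genusClassNumber_eq_gBitCfg redeiReichardt_fourTwoCard_classGroup_holds _ ht ht2 hinj
  have hR : (fun i => (![q, r] : Fin 2 → ℕ) i % 8) = ![5, 5] := by funext i; fin_cases i <;> simp [hq5, hr5]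
  have hB : (fun a b => kroneckerBit ((![q, r] : Fin 2 → ℕ) b) ((![q, r] : Fin 2 → ℕ) a)) =
      (![![0, kroneckerBit r q], ![kroneckerBit r q, 0]] : Fin 2 → Fin 2 → ZMod 2) := by
    have hswap : kroneckerBit q r = kroneckerBit r q := by
      rw [kroneckerBit_swap hq hr hq2 hr2 hqr]; simp [chi4Bit, show q % 4 = 1 by omega]
    funext a b
    fin_cases a <;> fin_cases b
    · simpa using kroneckerBit_self hq
    · simp
    · simp [hswap]
    · simpa using kroneckerBit_self hr
  have hprod : ∏ i, (![q, r] : Fin 2 → ℕ) i = q * r := by rw [Fin.prod_univ_two]; rfl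
  rw [hprod, hR, hB, gBitCfg_55] at h
  unfold gK
  rw [← ZMod.natCast_eq_one_iff_odd, h]
  exact zero_ne_one

/-- **`𝓛(qr)` is EVEN, for ANY sign choice**, for distinct primes `q ≡ r ≡ 5 (mod 8)`: TYZ Thm. 1.1 (`h11`: `qr ≡ 1 (mod 8)`,
`𝓛(qr) ≡ Σ₁(qr) = g(qr) (mod 2)`) and `g(qr)` even. CONDITIONAL on `h11`. [cite: TianYuanZhang2017, Thm. 1.1 (p0002 L90–L99)] -/
theorem even_of_isScriptL_mul_55 (h11 : thm11_parity_of_scriptL) {q r : ℕ} (hq : q.Prime) (hr : r.Prime) (hq5 : q % 8 = 5)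
    (hr5 : r % 8 = 5) (hqr : q ≠ r) {L : ℤ} (hL : IsScriptL (q * r) L) : Even L := by
  have hqr1 : (q * r) % 8 = 1 := by rw [Nat.mul_mod, hq5, hr5]
  have hsq : Squarefree (q * r) := by
    rw [Nat.squarefree_mul ((Nat.coprime_primes hq hr).mpr hqr)]
    exact ⟨hq.squarefree, hr.squarefree⟩
  obtain ⟨L', hL', hpar⟩ := h11 (q * r) hsq (Or.inl hqr1) GenusField (isGenusFieldFamily_genusField _)
  rw [genusSum₁_prime_mul hq hr hqr (by omega) (by omega)] at hpar
  have hg0 : ((genusClassNumber (GenusField (q * r)) : ℕ) : ZMod 2) = 0 := by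
    rcases Nat.even_or_odd (genusClassNumber (GenusField (q * r))) with he | ho
    · exact (ZMod.natCast_eq_zero_iff_even.mpr he)
    · exact absurd ho (not_odd_gK_mul_55 hq hr hq5 hr5 hqr)
  rw [hg0] at hpar
  have hL'even : Even L' := (ZMod.intCast_eq_zero_iff_even.mp hpar)
  have hsq' : L ^ 2 = L' ^ 2 := by
    have h : ((L : ℂ)) ^ 2 = ((L' : ℂ)) ^ 2 := by rw [hL, hL']
    exact_mod_cast h
  rcases sq_eq_sq_iff_eq_or_eq_neg.mp hsq' with h | h
  · rw [h]; exact hL'even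
  · rw [h]; exact hL'even.neg

end ThetaDescent

end Summit.BirchSwinnertonDyer.Rank1Residual.P2

end
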